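import Summits.Ventures.PercRepro.RankLevelSetRuleQCell

/-!
# PercRepro — RULE Q AT THE TIGHT LAYER: THE CELL INEQUALITIES `RhatCell q k` BY KERNEL EVALUATION (RankLevelSetRuleQCellEvalQ7B; night-1, gen 14)

Each theorem `rhatCell_q_k : RhatCell q k` (`∀ m ≤ q, Φ(q+k, q) ≤ R̂(q, k, m)`, RankLevelSetRuleQCell) is discharged by
`interval_cases m` and `norm_num` on the unfolded binomial sums (`Nat.choose` by its recursion; the
`Finset.Ioo`-sums as `Finset.range`-sums via `sum_Ioo_nat`). No `native_decide`, no `decide` on the rationals. With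
`hallUp_of_ncard_eq_of_rhatCell` each cell gives the UP form of C-044 at the tight layer `#E = (q+k) + q` of the cell
`(q+k, q)` for every finite matroid; the DOWN form is `hallDown_of_ncard_eq`. Cells: (7,8), (7,9), (7,10).
Axioms: standard.
-/

namespace PercRepro

open Finset

/-- `Φ(15, 7) ≤ R̂(7, 8, 0)` (the cell `(15, 7)` at `#P = 0`), by kernel evaluation. -/
theorem rhatCell_7_8_0 : phiK (7 + 8) 7 ≤ rhat 7 8 0 := by
  simp only [rhat, phiK, mhat, sum_Ioo_nat]
  norm_num [Finset.sum_range_succ, Nat.choose, Nat.min_def]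

/-- `Φ(15, 7) ≤ R̂(7, 8, 1)` (the cell `(15, 7)` at `#P = 1`), by kernel evaluation. -/
theorem rhatCell_7_8_1 : phiK (7 + 8) 7 ≤ rhat 7 8 1 := by
  simp only [rhat, phiK, mhat, sum_Ioo_nat]
  norm_num [Finset.sum_range_succ, Nat.choose, Nat.min_def]

/-- `Φ(15, 7) ≤ R̂(7, 8, 2)` (the cell `(15, 7)` at `#P = 2`), by kernel evaluation. -/
theorem rhatCell_7_8_2 : phiK (7 + 8) 7 ≤ rhat 7 8 2 := by
  simp only [rhat, phiK, mhat, sum_Ioo_nat]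
  norm_num [Finset.sum_range_succ, Nat.choose, Nat.min_def]

/-- `Φ(15, 7) ≤ R̂(7, 8, 3)` (the cell `(15, 7)` at `#P = 3`), by kernel evaluation. -/
theorem rhatCell_7_8_3 : phiK (7 + 8) 7 ≤ rhat 7 8 3 := by
  simp only [rhat, phiK, mhat, sum_Ioo_nat]
  norm_num [Finset.sum_range_succ, Nat.choose, Nat.min_def]

/-- `Φ(15, 7) ≤ R̂(7, 8, 4)` (the cell `(15, 7)` at `#P = 4`), by kernel evaluation. -/
theorem rhatCell_7_8_4 : phiK (7 + 8) 7 ≤ rhat 7 8 4 := by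
  simp only [rhat, phiK, mhat, sum_Ioo_nat]
  norm_num [Finset.sum_range_succ, Nat.choose, Nat.min_def]

/-- `Φ(15, 7) ≤ R̂(7, 8, 5)` (the cell `(15, 7)` at `#P = 5`), by kernel evaluation. -/
theorem rhatCell_7_8_5 : phiK (7 + 8) 7 ≤ rhat 7 8 5 := by
  simp only [rhat, phiK, mhat, sum_Ioo_nat]
  norm_num [Finset.sum_range_succ, Nat.choose, Nat.min_def]

/-- `Φ(15, 7) ≤ R̂(7, 8, 6)` (the cell `(15, 7)` at `#P = 6`), by kernel evaluation. -/
theorem rhatCell_7_8_6 : phiK (7 + 8) 7 ≤ rhat 7 8 6 := by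
  simp only [rhat, phiK, mhat, sum_Ioo_nat]
  norm_num [Finset.sum_range_succ, Nat.choose, Nat.min_def]

/-- `Φ(15, 7) ≤ R̂(7, 8, 7)` (the cell `(15, 7)` at `#P = 7`), by kernel evaluation. -/
theorem rhatCell_7_8_7 : phiK (7 + 8) 7 ≤ rhat 7 8 7 := by
  simp only [rhat, phiK, mhat, sum_Ioo_nat]
  norm_num [Finset.sum_range_succ, Nat.choose, Nat.min_def]

/-- The cell `(15, 7)` (`q = 7`, `k = 8`): `Φ(15, 7) ≤ R̂(7, 8, m)` for every `m ≤ 7`. -/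
theorem rhatCell_7_8 : RhatCell 7 8 := by
  intro m hm
  interval_cases m
  · exact rhatCell_7_8_0
  · exact rhatCell_7_8_1
  · exact rhatCell_7_8_2
  · exact rhatCell_7_8_3
  · exact rhatCell_7_8_4
  · exact rhatCell_7_8_5
  · exact rhatCell_7_8_6
  · exact rhatCell_7_8_7

/-- `Φ(16, 7) ≤ R̂(7, 9, 0)` (the cell `(16, 7)` at `#P = 0`), by kernel evaluation. -/
theorem rhatCell_7_9_0 : phiK (7 + 9) 7 ≤ rhat 7 9 0 := by
  simp only [rhat, phiK, mhat, sum_Ioo_nat]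
  norm_num [Finset.sum_range_succ, Nat.choose, Nat.min_def]

/-- `Φ(16, 7) ≤ R̂(7, 9, 1)` (the cell `(16, 7)` at `#P = 1`), by kernel evaluation. -/
theorem rhatCell_7_9_1 : phiK (7 + 9) 7 ≤ rhat 7 9 1 := by
  simp only [rhat, phiK, mhat, sum_Ioo_nat]
  norm_num [Finset.sum_range_succ, Nat.choose, Nat.min_def]

/-- `Φ(16, 7) ≤ R̂(7, 9, 2)` (the cell `(16, 7)` at `#P = 2`), by kernel evaluation. -/
theorem rhatCell_7_9_2 : phiK (7 + 9) 7 ≤ rhat 7 9 2 := by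
  simp only [rhat, phiK, mhat, sum_Ioo_nat]
  norm_num [Finset.sum_range_succ, Nat.choose, Nat.min_def]

/-- `Φ(16, 7) ≤ R̂(7, 9, 3)` (the cell `(16, 7)` at `#P = 3`), by kernel evaluation. -/
theorem rhatCell_7_9_3 : phiK (7 + 9) 7 ≤ rhat 7 9 3 := by
  simp only [rhat, phiK, mhat, sum_Ioo_nat]
  norm_num [Finset.sum_range_succ, Nat.choose, Nat.min_def]

/-- `Φ(16, 7) ≤ R̂(7, 9, 4)` (the cell `(16, 7)` at `#P = 4`), by kernel evaluation. -/
theorem rhatCell_7_9_4 : phiK (7 + 9) 7 ≤ rhat 7 9 4 := by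
  simp only [rhat, phiK, mhat, sum_Ioo_nat]
  norm_num [Finset.sum_range_succ, Nat.choose, Nat.min_def]

/-- `Φ(16, 7) ≤ R̂(7, 9, 5)` (the cell `(16, 7)` at `#P = 5`), by kernel evaluation. -/
theorem rhatCell_7_9_5 : phiK (7 + 9) 7 ≤ rhat 7 9 5 := by
  simp only [rhat, phiK, mhat, sum_Ioo_nat]
  norm_num [Finset.sum_range_succ, Nat.choose, Nat.min_def]

/-- `Φ(16, 7) ≤ R̂(7, 9, 6)` (the cell `(16, 7)` at `#P = 6`), by kernel evaluation. -/
theorem rhatCell_7_9_6 : phiK (7 + 9) 7 ≤ rhat 7 9 6 := by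
  simp only [rhat, phiK, mhat, sum_Ioo_nat]
  norm_num [Finset.sum_range_succ, Nat.choose, Nat.min_def]

/-- `Φ(16, 7) ≤ R̂(7, 9, 7)` (the cell `(16, 7)` at `#P = 7`), by kernel evaluation. -/
theorem rhatCell_7_9_7 : phiK (7 + 9) 7 ≤ rhat 7 9 7 := by
  simp only [rhat, phiK, mhat, sum_Ioo_nat]
  norm_num [Finset.sum_range_succ, Nat.choose, Nat.min_def]

/-- The cell `(16, 7)` (`q = 7`, `k = 9`): `Φ(16, 7) ≤ R̂(7, 9, m)` for every `m ≤ 7`. -/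
theorem rhatCell_7_9 : RhatCell 7 9 := by
  intro m hm
  interval_cases m
  · exact rhatCell_7_9_0
  · exact rhatCell_7_9_1
  · exact rhatCell_7_9_2
  · exact rhatCell_7_9_3
  · exact rhatCell_7_9_4
  · exact rhatCell_7_9_5
  · exact rhatCell_7_9_6
  · exact rhatCell_7_9_7

/-- `Φ(17, 7) ≤ R̂(7, 10, 0)` (the cell `(17, 7)` at `#P = 0`), by kernel evaluation. -/
theorem rhatCell_7_10_0 : phiK (7 + 10) 7 ≤ rhat 7 10 0 := by
  simp only [rhat, phiK, mhat, sum_Ioo_nat]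
  norm_num [Finset.sum_range_succ, Nat.choose, Nat.min_def]

/-- `Φ(17, 7) ≤ R̂(7, 10, 1)` (the cell `(17, 7)` at `#P = 1`), by kernel evaluation. -/
theorem rhatCell_7_10_1 : phiK (7 + 10) 7 ≤ rhat 7 10 1 := by
  simp only [rhat, phiK, mhat, sum_Ioo_nat]
  norm_num [Finset.sum_range_succ, Nat.choose, Nat.min_def]

/-- `Φ(17, 7) ≤ R̂(7, 10, 2)` (the cell `(17, 7)` at `#P = 2`), by kernel evaluation. -/
theorem rhatCell_7_10_2 : phiK (7 + 10) 7 ≤ rhat 7 10 2 := by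
  simp only [rhat, phiK, mhat, sum_Ioo_nat]
  norm_num [Finset.sum_range_succ, Nat.choose, Nat.min_def]

/-- `Φ(17, 7) ≤ R̂(7, 10, 3)` (the cell `(17, 7)` at `#P = 3`), by kernel evaluation. -/
theorem rhatCell_7_10_3 : phiK (7 + 10) 7 ≤ rhat 7 10 3 := by
  simp only [rhat, phiK, mhat, sum_Ioo_nat]
  norm_num [Finset.sum_range_succ, Nat.choose, Nat.min_def]

/-- `Φ(17, 7) ≤ R̂(7, 10, 4)` (the cell `(17, 7)` at `#P = 4`), by kernel evaluation. -/
theorem rhatCell_7_10_4 : phiK (7 + 10) 7 ≤ rhat 7 10 4 := by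
  simp only [rhat, phiK, mhat, sum_Ioo_nat]
  norm_num [Finset.sum_range_succ, Nat.choose, Nat.min_def]

/-- `Φ(17, 7) ≤ R̂(7, 10, 5)` (the cell `(17, 7)` at `#P = 5`), by kernel evaluation. -/
theorem rhatCell_7_10_5 : phiK (7 + 10) 7 ≤ rhat 7 10 5 := by
  simp only [rhat, phiK, mhat, sum_Ioo_nat]
  norm_num [Finset.sum_range_succ, Nat.choose, Nat.min_def]

/-- `Φ(17, 7) ≤ R̂(7, 10, 6)` (the cell `(17, 7)` at `#P = 6`), by kernel evaluation. -/
theorem rhatCell_7_10_6 : phiK (7 + 10) 7 ≤ rhat 7 10 6 := by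
  simp only [rhat, phiK, mhat, sum_Ioo_nat]
  norm_num [Finset.sum_range_succ, Nat.choose, Nat.min_def]

/-- `Φ(17, 7) ≤ R̂(7, 10, 7)` (the cell `(17, 7)` at `#P = 7`), by kernel evaluation. -/
theorem rhatCell_7_10_7 : phiK (7 + 10) 7 ≤ rhat 7 10 7 := by
  simp only [rhat, phiK, mhat, sum_Ioo_nat]
  norm_num [Finset.sum_range_succ, Nat.choose, Nat.min_def]

/-- The cell `(17, 7)` (`q = 7`, `k = 10`): `Φ(17, 7) ≤ R̂(7, 10, m)` for every `m ≤ 7`. -/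
theorem rhatCell_7_10 : RhatCell 7 10 := by
  intro m hm
  interval_cases m
  · exact rhatCell_7_10_0
  · exact rhatCell_7_10_1
  · exact rhatCell_7_10_2
  · exact rhatCell_7_10_3
  · exact rhatCell_7_10_4
  · exact rhatCell_7_10_5
  · exact rhatCell_7_10_6
  · exact rhatCell_7_10_7

end PercRepro
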